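import Mathlib
import Summits.ValiantsHypothesis.ValiantsHypothesis.Theorems.BinomialElusiveBinomialCandidateMonomialSubstitution
import Literature.Combinatorics.SimpleGraph.ShortEvenClosedWalk

/-!
# Crux `BinomialElusive.PeelingLemma` (stmt-ValiantsHypothesis-7391) — the HONEST case at `O(log m)`

The valuative (honest) case of the peeling lemma is in the tree with bound `⌊log₂ m⌋²`, `m ≥ 64`
(`BinomialCandidateStubs.integralPeeling_valuative`): if every target exponent `N a_i`, `N b_i` of
a formal solution `Γ(p) = (t^{N a_i} + t^{N b_i})_i` is a sum of two valuations from
`{0} ∪ {ord p_j}`, the `2m` exponents satisfy a short nonzero integer relation.  The girth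
mechanism gives the TRUE order `O(log m)`; this file proves the same statements with bound
`4 ⌊log₂ m⌋ + 8` for every `m ≥ 1`:
* `exists_short_even_closed_walk_linear` — folklore irregular Moore bound (`|E| ≥ 2|V|`,
  `|V| ≤ m` ⇒ an even closed walk of length `≤ 4 ⌊log₂ m⌋ + 8` using some edge exactly once); the
  proof of `Literature.Combinatorics.SimpleGraph.exists_short_even_closed_walk` verbatim, its final
  weakening `4(⌊log₂ m⌋ + 2) ≤ ⌊log₂ m⌋²` (which needs `m ≥ 64`) dropped;
* `shortRelation_of_edges_linear`, `peeling_valuative_linear`, `integralPeeling_valuative_linear`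
  — combinatorial core and honest case (proofs as in `ValuativePeeling`; degenerate data redone
  at length `2`, `shortRelation_two_of_not_injective`).
Ladder of length bounds `f(m)` for the crux: `2m(2m+1)^{m-1}` for ALL quadratic `Γ`
(`PeelingLemmaBaseline.peelingLemma_eliminationBaseline`); honest case `4 ⌊log₂ m⌋ + 8` (here;
`Θ(log m)` is sharp for monomial substitutions on a high-girth `4`-regular multigraph); crux
`⌊log₂ m⌋²`.  NOT here: anything on the cancellation case.
-/

-- layout Summits/ValiantsHypothesis/ValiantsHypothesis forces the duplicated namespace component
set_option linter.dupNamespace false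

namespace Summit.ValiantsHypothesis.ValiantsHypothesis.Theorems.PeelingLemmaHonest

open scoped BigOperators
open Finset
open Literature.Combinatorics.SimpleGraph

/-! ## 1. The girth lemma with a linear length bound -/

/-- **Short even closed walk, linear bound.**  If `E ⊆ Sym2 V` has `|E| ≥ 2|V|`, `|V| ≤ m`
(`V` nonempty), there is a closed walk along `E` of EVEN length `L ≤ 4 ⌊log₂ m⌋ + 8` with a step
whose edge is traversed exactly once (folklore Moore bound; the Literature proof verbatim). -/
theorem exists_short_even_closed_walk_linear {V : Type*} [Fintype V] [DecidableEq V] [Nonempty V]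
    (E : Finset (Sym2 V)) {m : ℕ} (hV : Fintype.card V ≤ m)
    (hE : 2 * Fintype.card V ≤ #E) :
    ∃ (L : ℕ) (ω : ℕ → V) (s₀ : ℕ), L ≤ 4 * Nat.log 2 m + 8 ∧ Even L ∧ s₀ < L ∧ ω L = ω 0 ∧
      (∀ s < L, s(ω s, ω (s + 1)) ∈ E) ∧
      ∀ s < L, s(ω s, ω (s + 1)) = s(ω s₀, ω (s₀ + 1)) → s = s₀ := by
  classical
  -- incidence numbers
  let inc : V → Sym2 V → ℕ := fun v =>
    Sym2.lift ⟨fun x y => (if x = v then 1 else 0) + (if y = v then 1 else 0), fun _ _ => add_comm _ _⟩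
  have hinc : ∀ v x y, inc v s(x, y) = (if x = v then 1 else 0) + (if y = v then 1 else 0) :=
    fun v x y => rfl
  -- a minimal vertex set `S` with `|E[S]| ≥ 2 |S|`
  let ES : Finset V → Finset (Sym2 V) := fun S => E.filter fun e => ∀ w ∈ e, w ∈ S
  have hES : ∀ S e, e ∈ ES S ↔ e ∈ E ∧ ∀ w ∈ e, w ∈ S := fun S e => by simp [ES]
  let fam : Finset (Finset V) := univ.powerset.filter fun S => S.Nonempty ∧ 2 * #S ≤ #(ES S)
  have huniv : (univ : Finset V) ∈ fam := by
    refine mem_filter.mpr ⟨mem_powerset.mpr Subset.rfl, univ_nonempty, ?_⟩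
    have : ES univ = E := by ext e; simp [ES]
    rw [this, card_univ]; exact hE
  obtain ⟨S, hSfam, hSmin⟩ := exists_min_image fam card ⟨univ, huniv⟩
  obtain ⟨-, hSne, hS2⟩ := mem_filter.mp hSfam
  have hmin : ∀ S' : Finset V, S'.Nonempty → 2 * #S' ≤ #(ES S') → #S ≤ #S' := fun S' h1 h2 =>
    hSmin S' (mem_filter.mpr ⟨mem_powerset.mpr (subset_univ _), h1, h2⟩)
  have hdeg3 := EvenClosedWalk.three_le_deg_of_minimal hinc E ES hES S hS2 hmin
  -- breadth-first data inside `S` for the edge set `E[S]`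
  obtain ⟨r, hr⟩ := hSne
  let F : Finset (Sym2 V) := ES S
  let B : ℕ → Finset V := fun k =>
    Nat.rec {r} (fun _ Bk => Bk ∪ univ.filter fun y => ∃ x ∈ Bk, s(x, y) ∈ F) k
  have hB0 : B 0 = {r} := rfl
  have hBs : ∀ k, B (k + 1) = B k ∪ univ.filter fun y => ∃ x ∈ B k, s(x, y) ∈ F := fun k => rfl
  let Lv : ℕ → Finset V := fun k => if k = 0 then {r} else B k \ B (k - 1)
  have hL0 : Lv 0 = {r} := by simp [Lv]
  have hLs : ∀ k, Lv (k + 1) = B (k + 1) \ B k := fun k => by simp [Lv]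
  -- parent choice
  have hex : ∀ k v, v ∈ Lv (k + 1) → ∃ x ∈ Lv k, s(x, v) ∈ F := fun k v hv =>
    EvenClosedWalk.exists_parent hB0 hBs hL0 hLs hv
  let π : V → V := fun v =>
    if h : ∃ p : ℕ × V, v ∈ Lv (p.1 + 1) ∧ p.2 ∈ Lv p.1 ∧ s(p.2, v) ∈ F then (Classical.choose h).2
    else v
  have hπ : ∀ k v, v ∈ Lv (k + 1) → π v ∈ Lv k ∧ s(π v, v) ∈ F := by
    intro k v hv
    have h : ∃ p : ℕ × V, v ∈ Lv (p.1 + 1) ∧ p.2 ∈ Lv p.1 ∧ s(p.2, v) ∈ F := by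
      obtain ⟨x, hx, hxe⟩ := hex k v hv
      exact ⟨(k, x), hv, hx, hxe⟩
    have hspec := Classical.choose_spec h
    have hk : (Classical.choose h).1 = k := by
      have := EvenClosedWalk.L_eq_of_mem hB0 hBs hL0 hLs hspec.1 hv
      omega
    simp only [π, dif_pos h]
    rw [← hk]
    exact ⟨hspec.2.1, hspec.2.2⟩
  -- radius, levels `1 … R`, parent edges, non-parent edges meeting the ball
  set R : ℕ := Nat.log 2 m + 2 with hRdef
  have hR : 1 ≤ R := by omega
  let U : Finset V := (range R).biUnion fun k => Lv (k + 1)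
  let PE : Finset (Sym2 V) := U.image fun u => s(π u, u)
  let NPt : Finset (Sym2 V) := (F \ PE).filter fun e => ∃ v ∈ B (R - 1), v ∈ e
  have hNPt : ∀ e, e ∈ NPt ↔ e ∈ F \ PE ∧ ∃ v ∈ B (R - 1), v ∈ e := fun e => by
    simp only [NPt, mem_filter]
  -- balls stay inside `S`, so `|L R| ≤ |S| ≤ |V| ≤ m < 2^{R-1}`
  have hBS : ∀ k, B k ⊆ S := by
    intro k
    induction k with
    | zero => rw [hB0]; exact singleton_subset_iff.mpr hr
    | succ k ih =>
      rw [hBs]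
      refine union_subset ih fun y hy => ?_
      obtain ⟨-, x, -, hxy⟩ := mem_filter.mp hy
      exact ((hES S _).mp hxy).2 y (Sym2.mem_mk_right x y)
  have hsmall : #(Lv R) < 2 ^ (R - 1) := by
    calc #(Lv R) ≤ #S := card_le_card ((EvenClosedWalk.L_subset_B hB0 hL0 hLs R).trans (hBS R))
      _ ≤ Fintype.card V := card_le_univ S
      _ ≤ m := hV
      _ < 2 ^ (Nat.log 2 m).succ := Nat.lt_pow_succ_log_self (by norm_num) m
      _ = 2 ^ (R - 1) := by rw [hRdef]; rfl
  have hdegL : ∀ i < R, ∀ v ∈ Lv i, 3 ≤ ∑ e ∈ F, inc v e := fun i _ v hv =>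
    hdeg3 v (hBS i (EvenClosedWalk.L_subset_B hB0 hL0 hLs i hv))
  -- two distinct non-parent edges meeting the ball, and their closed walks
  obtain ⟨e₁, he₁, e₂, he₂, hne⟩ := EvenClosedWalk.two_nonparent hB0 hBs hL0 hLs hπ hinc hR rfl rfl hdegL
    NPt hNPt hsmall
  obtain ⟨he₁F, hball₁⟩ := (hNPt e₁).mp he₁
  obtain ⟨he₂F, hball₂⟩ := (hNPt e₂).mp he₂
  have he₁PE : e₁ ∉ PE := (mem_sdiff.mp he₁F).2
  have he₂PE : e₂ ∉ PE := (mem_sdiff.mp he₂F).2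
  obtain ⟨ℓ₁, ω₁, j₁, hℓ₁, hj₁, h0₁, hend₁, hE₁, hP₁, hedge₁⟩ :=
    EvenClosedWalk.closed_walk_of_nonparent hB0 hBs hL0 hLs hπ hR rfl rfl (mem_sdiff.mp he₁F).1 hball₁
  obtain ⟨ℓ₂, ω₂, j₂, hℓ₂, hj₂, h0₂, hend₂, hE₂, hP₂, hedge₂⟩ :=
    EvenClosedWalk.closed_walk_of_nonparent hB0 hBs hL0 hLs hπ hR rfl rfl (mem_sdiff.mp he₂F).1 hball₂
  have hFE : F ⊆ E := filter_subset _ _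
  -- length bookkeeping: every walk below has length `≤ 2R`, so `≤ 4R = 4 ⌊log₂ m⌋ + 8` in all
  -- once-traversed edge in a single walk
  have honce₁ : ∀ s < ℓ₁, s(ω₁ s, ω₁ (s + 1)) = e₁ → s = j₁ := fun s hs h => by
    by_contra hsj; exact he₁PE (h ▸ hP₁ s hs hsj)
  have honce₂ : ∀ s < ℓ₂, s(ω₂ s, ω₂ (s + 1)) = e₂ → s = j₂ := fun s hs h => by
    by_contra hsj; exact he₂PE (h ▸ hP₂ s hs hsj)
  rcases Nat.even_or_odd ℓ₁ with hev₁ | hodd₁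
  · refine ⟨ℓ₁, ω₁, j₁, by omega, hev₁, hj₁, by rw [hend₁, h0₁], fun s hs => hFE (hE₁ s hs), ?_⟩
    intro s hs h
    rw [hedge₁] at h
    exact honce₁ s hs h
  rcases Nat.even_or_odd ℓ₂ with hev₂ | hodd₂
  · refine ⟨ℓ₂, ω₂, j₂, by omega, hev₂, hj₂, by rw [hend₂, h0₂], fun s hs => hFE (hE₂ s hs), ?_⟩
    intro s hs h
    rw [hedge₂] at h
    exact honce₂ s hs h
  -- both odd: concatenate at the root
  refine ⟨ℓ₁ + ℓ₂, fun s => if s ≤ ℓ₁ then ω₁ s else ω₂ (s - ℓ₁), j₁, by omega,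
    Odd.add_odd hodd₁ hodd₂, by omega, ?_, ?_, ?_⟩
  · have h : ¬ ℓ₁ + ℓ₂ ≤ ℓ₁ := by omega
    simp only [h, if_false, Nat.zero_le, if_true, Nat.add_sub_cancel_left, hend₂, h0₁]
  · intro s hs
    by_cases h1 : s + 1 ≤ ℓ₁
    · have h0 : s ≤ ℓ₁ := by omega
      simp only [h0, h1, if_true]
      exact hFE (hE₁ s (by omega))
    · by_cases h0 : s ≤ ℓ₁
      · obtain hs1 : ℓ₁ = s := by omega
        subst hs1
        simp only [le_rfl, if_true, h1, if_false, hend₁, ← h0₂, show ℓ₁ + 1 - ℓ₁ = 0 + 1 by omega]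
        exact hFE (hE₂ 0 (by omega))
      · simp only [h0, h1, if_false, show s + 1 - ℓ₁ = (s - ℓ₁) + 1 by omega]
        exact hFE (hE₂ (s - ℓ₁) (by omega))
  · intro s hs h
    have hj1' : j₁ + 1 ≤ ℓ₁ := hj₁
    simp only [hj₁.le, hj1', if_true, hedge₁] at h
    by_cases h1 : s + 1 ≤ ℓ₁
    · have h0 : s ≤ ℓ₁ := by omega
      simp only [h0, h1, if_true] at h
      exact honce₁ s (by omega) h
    · exfalso
      by_cases h0 : s ≤ ℓ₁
      · obtain hs1 : ℓ₁ = s := by omega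
        subst hs1
        simp only [le_rfl, if_true, h1, if_false, hend₁, ← h0₂, show ℓ₁ + 1 - ℓ₁ = 0 + 1 by omega] at h
        -- step `0` of `ω₂` is a parent edge or `e₂`, neither is `e₁`
        by_cases hj20 : (0 : ℕ) = j₂
        · exact hne (h.symm.trans (hj20 ▸ hedge₂))
        · exact he₁PE (h ▸ hP₂ 0 (by omega) hj20)
      · simp only [h0, h1, if_false, show s + 1 - ℓ₁ = (s - ℓ₁) + 1 by omega] at h
        by_cases hj2 : s - ℓ₁ = j₂
        · exact hne (h.symm.trans (hj2 ▸ hedge₂))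
        · exact he₁PE (h ▸ hP₂ (s - ℓ₁) (by omega) hj2)


/-! ## 2. Degenerate data at length `2` -/

/-- If the `2m` exponents `a_i, b_i` are not pairwise distinct, two equal ones give a nonzero
relation of length `2`. -/
theorem shortRelation_two_of_not_injective {m : ℕ} (a b : Fin m → ℕ)
    (h : ¬ Function.Injective (Sum.elim a b)) :
    ∃ u v : Fin m → ℤ, (u, v) ≠ 0 ∧ ∑ i, (|u i| + |v i|) ≤ (2 : ℤ) ∧
      ∑ i, (u i * (a i : ℤ) + v i * (b i : ℤ)) = 0 := by
  classical
  obtain ⟨x, y, hxy, hne⟩ := Function.not_injective_iff.mp h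
  -- coefficient vector on `Fin m ⊕ Fin m`: `+1` at `x`, `-1` at `y`
  set c : Fin m ⊕ Fin m → ℤ := fun z => (if z = x then 1 else 0) - (if z = y then 1 else 0) with hc
  set e : Fin m ⊕ Fin m → ℤ := fun z => ((Sum.elim a b z : ℕ) : ℤ) with he
  have hcx : c x = 1 := by simp [hc, hne]
  have hsupp : ∀ z, z ≠ x → z ≠ y → c z = 0 := fun z hx hy => by simp [hc, hx, hy]
  have habs : ∑ z, |c z| = 2 := by
    rw [← Finset.sum_subset (Finset.subset_univ ({x, y} : Finset (Fin m ⊕ Fin m)))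
      (fun z _ hz => by
        rw [Finset.mem_insert, Finset.mem_singleton, not_or] at hz
        rw [hsupp z hz.1 hz.2, abs_zero]),
      Finset.sum_pair hne]
    simp [hc, hne, Ne.symm hne]
  have hrel : ∑ z, c z * e z = 0 := by
    rw [← Finset.sum_subset (Finset.subset_univ ({x, y} : Finset (Fin m ⊕ Fin m)))
      (fun z _ hz => by
        rw [Finset.mem_insert, Finset.mem_singleton, not_or] at hz
        rw [hsupp z hz.1 hz.2, zero_mul]),
      Finset.sum_pair hne]
    have hexy : e x = e y := by simp [he, hxy]
    simp [hc, hne, Ne.symm hne, hexy]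
  refine ⟨fun i => c (Sum.inl i), fun i => c (Sum.inr i), ?_, ?_, ?_⟩
  · intro h0
    have h1 : ∀ i, c (Sum.inl i) = 0 := fun i => by simpa using congr_fun (congr_arg Prod.fst h0) i
    have h2 : ∀ i, c (Sum.inr i) = 0 := fun i => by simpa using congr_fun (congr_arg Prod.snd h0) i
    have : c x = 0 := by cases x with | inl i => exact h1 i | inr i => exact h2 i
    rw [hcx] at this; exact one_ne_zero this
  · rw [sum_add_distrib, ← habs, Fintype.sum_sum_type]
  · rw [← hrel, Fintype.sum_sum_type, ← sum_add_distrib]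
    simp [he]

/-! ## 3. The combinatorial core and the honest case, linear bound -/

namespace ValuativePeelingLinear

/-- **The combinatorial core, linear bound.**  If each of the `2m` numbers `N a_i`, `N b_i`
(`N > 0`, `m ≥ 1`) is `θ x + θ y` for two vertices of a finite `V`, `|V| ≤ m`, `θ : V → ℤ`, then
`a, b` satisfy a nonzero integer relation of length `≤ 4 ⌊log₂ m⌋ + 8`. -/
theorem shortRelation_of_edges_linear {m : ℕ} (hm : 1 ≤ m) (a b : Fin m → ℕ) {N : ℕ} (hN : 0 < N)
    {V : Type*} [Fintype V] [DecidableEq V] (hV : Fintype.card V ≤ m) (θ : V → ℤ)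
    (hval : ∀ i, ∀ e ∈ ({a i, b i} : Finset ℕ), ∃ x y, ((N * e : ℕ) : ℤ) = θ x + θ y) :
    ∃ u v : Fin m → ℤ, (u, v) ≠ 0 ∧ ∑ i, (|u i| + |v i|) ≤ ((4 * Nat.log 2 m + 8 : ℕ) : ℤ) ∧
      ∑ i, (u i * (a i : ℤ) + v i * (b i : ℤ)) = 0 := by
  classical
  by_cases hab : Function.Injective (Sum.elim a b)
  swap
  · obtain ⟨u, v, hne, hlen, hrel⟩ := shortRelation_two_of_not_injective a b hab
    exact ⟨u, v, hne, hlen.trans (by push_cast; omega), hrel⟩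
  obtain ⟨hinja, hinjb, hab'⟩ := Sum.elim_injective.mp hab
  -- edge values `Θ`, targets `X`
  set Θ : Sym2 V → ℤ := Sym2.lift ⟨fun x y => θ x + θ y, fun _ _ => add_comm _ _⟩ with hΘ
  set X : Fin m × Bool → ℤ := fun τ => ((N * (if τ.2 then b τ.1 else a τ.1) : ℕ) : ℤ) with hX
  -- every target exponent is an edge value
  have hedge : ∀ τ, ∃ ε, X τ = Θ ε := by
    rintro ⟨i, bb⟩
    cases bb
    · obtain ⟨x, y, h⟩ := hval i (a i) (by simp)
      exact ⟨s(x, y), by simpa [hX, hΘ] using h⟩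
    · obtain ⟨x, y, h⟩ := hval i (b i) (by simp)
      exact ⟨s(x, y), by simpa [hX, hΘ] using h⟩
  choose ε hε using hedge
  -- `X` (hence `ε`) is injective: the exponents are pairwise distinct
  have hXinj : Function.Injective X := by
    rintro ⟨i, bi⟩ ⟨j, bj⟩ h
    simp only [hX, Nat.cast_inj] at h
    have h' := Nat.eq_of_mul_eq_mul_left hN h
    cases bi <;> cases bj <;> simp only [Bool.false_eq_true, if_false, if_true] at h'
    · rw [hinja h']
    · exact absurd h' (hab' i j)
    · exact absurd h'.symm (hab' j i)
    · rw [hinjb h']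
  have hεinj : Function.Injective ε := fun τ τ' h => hXinj (by rw [hε τ, hε τ', h])
  -- the girth lemma on `E = image ε`
  have hm0 : 0 < m := by omega
  haveI : Nonempty V := by
    obtain ⟨x, -, -⟩ := hval ⟨0, hm0⟩ (a ⟨0, hm0⟩) (by simp)
    exact ⟨x⟩
  set E : Finset (Sym2 V) := univ.image ε with hE
  have hEcard : #E = 2 * m := by
    rw [hE, card_image_of_injective _ hεinj, card_univ, Fintype.card_prod, Fintype.card_fin,
      Fintype.card_bool, mul_comm]
  obtain ⟨L, ω, s₀, hL, hLeven, hs₀, hclosed, hωE, honce⟩ :=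
    exists_short_even_closed_walk_linear E hV (by rw [hEcard]; omega)
  -- the alternating edge sum, read on the targets
  set w : Fin m × Bool → ℤ := fun τ =>
    ∑ s ∈ range L, if s(ω s, ω (s + 1)) = ε τ then (-1 : ℤ) ^ s else 0 with hw
  -- each step's edge is `ε τ` for exactly one target `τ`
  have hfib : ∀ s < L, #(univ.filter fun τ => ε τ = s(ω s, ω (s + 1))) = 1 := by
    intro s hs
    obtain ⟨τ, -, hτ⟩ := mem_image.mp (hωE s hs)
    rw [card_eq_one]
    refine ⟨τ, eq_singleton_iff_unique_mem.mpr ⟨mem_filter.mpr ⟨mem_univ _, hτ⟩, fun τ' hτ' => ?_⟩⟩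
    exact hεinj ((mem_filter.mp hτ').2.trans hτ.symm)
  have hfib' : ∀ s < L, ∀ g : Fin m × Bool → ℤ, (∀ τ τ', ε τ = s(ω s, ω (s + 1)) →
      ε τ' = s(ω s, ω (s + 1)) → g τ = g τ') →
      ∑ τ, (if s(ω s, ω (s + 1)) = ε τ then g τ else 0) =
        ∑ τ ∈ univ.filter (fun τ => ε τ = s(ω s, ω (s + 1))), g τ := by
    intro s _ g _
    rw [sum_filter]
    exact sum_congr rfl fun τ _ => by simp only [eq_comm]
  refine ⟨fun i => w (i, false), fun i => w (i, true), ?_, ?_, ?_⟩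
  · -- nonzero: the target of the once-traversed edge has coefficient `± 1`
    obtain ⟨τ₀, -, hτ₀⟩ := mem_image.mp (hωE s₀ hs₀)
    have hw0 : w τ₀ = (-1) ^ s₀ := by
      simp only [hw]
      rw [sum_eq_single s₀]
      · rw [if_pos hτ₀.symm]
      · intro s hs hss
        rw [if_neg]
        intro h
        exact hss (honce s (mem_range.mp hs) (h.trans hτ₀))
      · intro h; exact absurd (mem_range.mpr hs₀) h
    have hne : w τ₀ ≠ 0 := by rw [hw0]; exact pow_ne_zero _ (by norm_num)
    intro h0
    obtain ⟨i, bb⟩ := τ₀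
    cases bb
    · exact hne (by simpa using congr_fun (congr_arg Prod.fst h0) i)
    · exact hne (by simpa using congr_fun (congr_arg Prod.snd h0) i)
  · -- length `≤ L ≤ 4 ⌊log₂ m⌋ + 8`
    have hlen : ∑ τ, |w τ| ≤ (L : ℤ) := by
      calc ∑ τ, |w τ| ≤ ∑ τ, ∑ s ∈ range L, (if s(ω s, ω (s + 1)) = ε τ then (1 : ℤ) else 0) := by
            refine sum_le_sum fun τ _ => (abs_sum_le_sum_abs _ _).trans (sum_le_sum fun s _ => ?_)
            split_ifs <;> simp
        _ = ∑ s ∈ range L, ∑ τ, (if s(ω s, ω (s + 1)) = ε τ then (1 : ℤ) else 0) := sum_comm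
        _ = ∑ s ∈ range L, (1 : ℤ) := by
            refine sum_congr rfl fun s hs => ?_
            rw [hfib' s (mem_range.mp hs) (fun _ => 1) (fun _ _ _ _ => rfl), sum_const,
              hfib s (mem_range.mp hs)]
            simp
        _ = L := by simp
    calc ∑ i, (|w (i, false)| + |w (i, true)|) = ∑ τ, |w τ| := by
          rw [Fintype.sum_prod_type]
          exact sum_congr rfl fun i _ => by simp [add_comm]
      _ ≤ L := hlen
      _ ≤ ((4 * Nat.log 2 m + 8 : ℕ) : ℤ) := by exact_mod_cast hL
  · -- the relation: `N Σ (u a + v b) = Σ_τ w τ X τ = Σ_s (-1)^s Θ(edge s) = 0`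
    have hNX : ∀ i, (w (i, false) * (a i : ℤ) + w (i, true) * (b i : ℤ)) * N =
        w (i, false) * X (i, false) + w (i, true) * X (i, true) := fun i => by
      simp only [hX, Bool.false_eq_true, if_false, if_true, Nat.cast_mul]; ring
    have hsumX : ∑ τ, w τ * X τ = ∑ s ∈ range L, (-1 : ℤ) ^ s * Θ (s(ω s, ω (s + 1))) := by
      calc ∑ τ, w τ * X τ
          = ∑ τ, ∑ s ∈ range L, (if s(ω s, ω (s + 1)) = ε τ then (-1 : ℤ) ^ s * Θ (ε τ) else 0) := by
            refine sum_congr rfl fun τ _ => ?_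
            rw [hw, sum_mul]
            exact sum_congr rfl fun s _ => by rw [ite_mul, zero_mul, hε τ]
        _ = ∑ s ∈ range L, ∑ τ, (if s(ω s, ω (s + 1)) = ε τ then (-1 : ℤ) ^ s * Θ (ε τ) else 0) :=
            sum_comm
        _ = ∑ s ∈ range L, (-1 : ℤ) ^ s * Θ (s(ω s, ω (s + 1))) := by
            refine sum_congr rfl fun s hs => ?_
            rw [hfib' s (mem_range.mp hs) (fun τ => (-1 : ℤ) ^ s * Θ (ε τ))
              (fun τ τ' h h' => by rw [h, h'])]
            rw [sum_congr rfl fun τ hτ => by rw [(mem_filter.mp hτ).2], sum_const,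
              hfib s (mem_range.mp hs)]
            simp
    have htel : ∑ s ∈ range L, (-1 : ℤ) ^ s * Θ (s(ω s, ω (s + 1))) = 0 := by
      have : ∀ s, Θ (s(ω s, ω (s + 1))) = (fun s => θ (ω s)) s + (fun s => θ (ω s)) (s + 1) :=
        fun s => by simp [hΘ]
      simp only [this]
      rw [BinomialCandidateStubs.MonomialSubstitution.alternating_sum_telescope, hclosed, Even.neg_one_pow hLeven, one_mul,
        sub_self]
    have hN0 : (N : ℤ) ≠ 0 := by exact_mod_cast hN.ne'
    have key : (∑ i, (w (i, false) * (a i : ℤ) + w (i, true) * (b i : ℤ))) * N = 0 := by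
      rw [sum_mul, sum_congr rfl fun i _ => hNX i]
      have : ∑ i, (w (i, false) * X (i, false) + w (i, true) * X (i, true)) = ∑ τ, w τ * X τ := by
        rw [Fintype.sum_prod_type]
        exact sum_congr rfl fun i _ => by simp [add_comm]
      rw [this, hsumX, htel]
    exact (mul_eq_zero.mp key).resolve_right hN0


end ValuativePeelingLinear

/-- **The valuative corner, vertex form, linear bound** (`m ≥ 1`): the conclusion of
`PeelingLemma` with bound `4 ⌊log₂ m⌋ + 8` from the sole hypothesis that every target exponent
`N a_i`, `N b_i` is `θ x + θ y` for two vertices `x, y ∈ Option (Fin (m-1))` and some potential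
`θ` (in the application `θ none = 0`, `θ (some j) = ord p_j`). -/
theorem peeling_valuative_linear {m : ℕ} (hm : 1 ≤ m) (a b : Fin m → ℕ) (N : ℕ) (hN : 0 < N)
    (θ : Option (Fin (m - 1)) → ℤ)
    (hval : ∀ i, ∀ e ∈ ({a i, b i} : Finset ℕ), ∃ x y, ((N * e : ℕ) : ℤ) = θ x + θ y) :
    ∃ u v : Fin m → ℤ, (u, v) ≠ 0 ∧ ∑ i, (|u i| + |v i|) ≤ ((4 * Nat.log 2 m + 8 : ℕ) : ℤ) ∧
      ∑ i, (u i * (a i : ℤ) + v i * (b i : ℤ)) = 0 :=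
  ValuativePeelingLinear.shortRelation_of_edges_linear hm a b hN
    (by rw [Fintype.card_option, Fintype.card_fin]; omega) θ hval

/-- **`PeelingLemma`, honest case, at length `O(log m)`** (every `m ≥ 1`, arbitrary `Γ`,
arbitrary Laurent `p`): if every target exponent `N a_i`, `N b_i` of a formal solution of
`Γ(p) = (t^{N a_i} + t^{N b_i})_i` is a sum of two valuations from `{0} ∪ {ord p_j}` — no target
exponent is created by cancellation — then the `2m` exponents satisfy a nonzero integer relation
of length `≤ 4 ⌊log₂ m⌋ + 8`.  (The hypotheses on `Γ` and the identity `Γ(p) = targets` are not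
used; the content is `peeling_valuative_linear`.  Compare `integralPeeling_valuative`: bound
`⌊log₂ m⌋²`, `m ≥ 64`.) -/
theorem integralPeeling_valuative_linear :
    ∀ m ≥ 1, ∀ (a b : Fin m → ℕ) (Γ : Fin m → MvPolynomial (Fin (m - 1)) ℂ) (N : ℕ)
      (p : Fin (m - 1) → LaurentSeries ℂ), (∀ i, (Γ i).totalDegree ≤ 2) → 0 < N →
      (∀ i, ∀ e ∈ ({a i, b i} : Finset ℕ), ∃ x y : Option (Fin (m - 1)),
        ((N * e : ℕ) : ℤ) = Option.elim x 0 (fun j => (p j).order) + Option.elim y 0 (fun j => (p j).order)) →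
      (∀ i, MvPolynomial.aeval p (Γ i) =
        HahnSeries.single ((N * a i : ℕ) : ℤ) (1 : ℂ) + HahnSeries.single ((N * b i : ℕ) : ℤ) (1 : ℂ)) →
      ∃ u v : Fin m → ℤ, (u, v) ≠ 0 ∧ ∑ i, (|u i| + |v i|) ≤ ((4 * Nat.log 2 m + 8 : ℕ) : ℤ) ∧
        ∑ i, (u i * (a i : ℤ) + v i * (b i : ℤ)) = 0 := by
  intro m hm a b _Γ N p _hΓ hN hval _hp
  exact peeling_valuative_linear hm a b N hN (fun x => Option.elim x 0 fun j => (p j).order) hval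

end Summit.ValiantsHypothesis.ValiantsHypothesis.Theorems.PeelingLemmaHonest
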